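import Literature.NumberTheory.EllipticCurves.HeegnerPointsRationality
import Literature.NumberTheory.EllipticCurves.HeegnerPointsShimuraReduction
import Literature.NumberTheory.EllipticCurves.ModularParamYRationality
import Literature.NumberTheory.EllipticCurves.ModularCurveManinConstantProofs
import HarnessLib

/-!
# Proof of `heegnerPointComplex_mem_range_map` (Darmon, *Rational points on modular elliptic curves*, Thm. 3.6)

Topic `NumberTheory/EllipticCurves`; the closing file of the "canonical model of `X₀(N)` at CM
points" chain.  The named fact `heegnerPointComplex_mem_range_map N W K`
(`HeegnerPointsRationality.lean`: a complex Heegner point `φ(τ)`, `τ ∈ HP_N(d_K)`, is the image of a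
`K`-rational point) was reduced in `HeegnerPointsShimuraReduction.lean`
(`heegnerPointComplex_mem_range_map_of_isAutEquivariantOnHeegner`, `isAutEquivariantOnHeegner_of_weierstrassP`)
to the transport of the values of the two modular functions `x = ℘_Λ(c·u)`, `y = ℘_Λ'(c·u)`
(`u = 2πi∫f`, `Λ = Λ_E`, `c` the Manin constant of the datum) along `Aut(ℂ)` at level-`N`
CM points: for `σ ∈ Aut(ℂ)` and `τ, τ'` with `LevelTransport N σ τ τ'`,
`σ(x(τ)) = x(τ')`, `σ(y(τ)) = y(τ')` (and poles correspond to poles).  This is proved here for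
**every** pair of `LevelTransport`-related points (`transport_weierstrassP_values`), by

* the local representation of `x, y ∈ K_N = ℂ(X₀(N))` at `τ` through the eight coordinate functions
  (`ModularCurveLocalRingsAtPoints`), whose values at `τ` are carried by `σ` to their values at `τ'`
  (`LevelTransport.apply_coordVal`, from `ModularCurveEisensteinCoordinates`);
* the `σ`-invariance of the `q`-expansions of `x, y` (`ModularParamXRationality`,
  `ModularParamYRationality`: `f` has rational coefficients, `Λ_E` rational invariants) and of the
  coordinate functions (`ModularCurveCoordinateRationality`), so that the transported representation
  is again a representation of `x, y`, now at `τ'`;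
* the dictionary between values of `x, y` at the places `P_τ` and `℘_Λ(c·u(τ)), ℘_Λ'(c·u(τ))`
  (`ModularParamXFunction`, `ModularParamYFunction`).

Hence `Dt.IsAutEquivariantOnHeegner D` for every datum and every `D` (`isAutEquivariantOnHeegner`), and
**`heegnerPointComplex_mem_range_map_holds`** (Darmon 2004, Thm. 3.6; Gross 1984, §3; Shimura 1971,
Thm. 7.14 with Prop. 6.9 for the classical route through the `ℚ`-structure of `X₀(N)`).

## References

* H. Darmon, *Rational Points on Modular Elliptic Curves*, CBMS 101, AMS 2004, Thm. 3.6, Thm. 3.7,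
  §3.7. [Darmon2004]
* G. Shimura, *Introduction to the arithmetic theory of automorphic functions*, 1971, §6.2, Thm. 7.14.
  [ShimuraIATAF1971]
* B. H. Gross, *Heegner points on X₀(N)*, in: Modular Forms (Durham 1983), 1984, §3. [Gross1984]
-/

noncomputable section

open Complex Filter Topology Set Function
open UpperHalfPlane hiding I
open scoped Real Topology Manifold MatrixGroups PeriodPair ModularForm WithZero
open ModularForm CongruenceSubgroup PeriodPair

universe u

namespace Literature.NumberTheory.EllipticCurves

open ModularForms

variable {N : ℕ} [NeZero N]

/-! ### `σ` carries the eight coordinate values at `τ` to those at `τ'` -/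

/-- The seventh coordinate `E₄E₄(Nτ)²/Δ` in terms of the lattice invariants: `1728·g₂h₂²/D`. [folklore] -/
theorem coordVal_six_eq (τ : ℍ) :
    coordVal N 6 τ = 1728 * ((ofUpperHalfPlane τ).g₂ * (ofUpperHalfPlane (levelPoint N τ)).g₂ ^ 2) /
      ((ofUpperHalfPlane τ).g₂ ^ 3 - 27 * (ofUpperHalfPlane τ).g₃ ^ 2) := by
  have hπ : (π : ℂ) ≠ 0 := by exact_mod_cast Real.pi_ne_zero
  have hD := discr_div_ne_zero τ
  have h6 : coordVal N 6 τ = E₄ τ * (scaleN N E₄ τ * scaleN N E₄ τ) / ModularForm.discriminant τ := rfl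
  rw [h6, E₄_eq_g₂, scaleN_E₄_eq_g₂, discriminant_eq_discr]
  field_simp
  ring

/-- The eighth coordinate `E₄³/Δ` is the first Eisenstein coordinate. [folklore] -/
theorem coordVal_seven_eq (τ : ℍ) : coordVal N 7 τ = eisCoord N 0 τ := by
  change E₄cube τ / ModularForm.discriminant τ = eisMonomial N 0 τ / ModularForm.discriminant τ
  rw [E₄cube_apply, eisMonomial_apply]

/-- **`σ(vᵢ(τ)) = vᵢ(τ')` for `LevelTransport`-related points** (all eight coordinates).
[folklore] -/
theorem LevelTransport.apply_coordVal {σ : ℂ ≃+* ℂ} {τ τ' : ℍ} (h : LevelTransport N σ τ τ')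
    (i : Fin 8) : σ (coordVal N i τ) = coordVal N i τ' := by
  have h6 : σ (coordVal N 6 τ) = coordVal N 6 τ' := by
    obtain ⟨μ, hμ, h₂, h₃, h₂', h₃'⟩ := h
    have hD := discr_div_ne_zero τ
    have hD' := discr_div_ne_zero τ'
    have hμ12 : μ ^ 12 ≠ 0 := pow_ne_zero _ hμ
    have hσD : σ ((ofUpperHalfPlane τ).g₂ ^ 3 - 27 * (ofUpperHalfPlane τ).g₃ ^ 2) =
        μ ^ 12 * ((ofUpperHalfPlane τ').g₂ ^ 3 - 27 * (ofUpperHalfPlane τ').g₃ ^ 2) := by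
      rw [map_sub, map_mul, map_pow, map_pow, h₂, h₃, map_ofNat]; ring
    rw [coordVal_six_eq, coordVal_six_eq, map_div₀, map_mul, map_mul, map_pow, map_ofNat, h₂, h₂', hσD]
    field_simp
  have hcast : ∀ j : Fin 6, σ (coordVal N (Fin.castLE (by norm_num) j) τ) = coordVal N (Fin.castLE (by norm_num) j) τ' :=
    fun j ↦ by rw [coordVal_castLE, coordVal_castLE]; exact h.apply_eisCoord j
  fin_cases i
  · exact hcast 0
  · exact hcast 1
  · exact hcast 2
  · exact hcast 3
  · exact hcast 4
  · exact hcast 5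
  · exact h6
  · change σ (coordVal N 7 τ) = coordVal N 7 τ'
    rw [coordVal_seven_eq, coordVal_seven_eq]
    exact h.apply_eisCoord 0

/-! ### Representations `x·q(v) = p(v)` at a point, and their transport -/

namespace ModularForms

/-- **Value from a representation**: if `x·q(v) = p(v)` with `q(v(τ)) ≠ 0` then `x ∈ O_{P_τ}` with value
`p(v(τ))/q(v(τ))`. [folklore] -/
theorem pointValuation_sub_div_lt_one_of_mul_aeval_eq (τ : ℍ) {x : modularFunctionField N}
    {p q : CoordPoly} (hq : MvPolynomial.eval (fun i ↦ coordVal N i τ) q ≠ 0)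
    (hpq : x * MvPolynomial.aeval (coordFn N) q = MvPolynomial.aeval (coordFn N) p) :
    pointValuation (N := N) τ (x - algebraMap ℂ (modularFunctionField N)
      (MvPolynomial.eval (fun i ↦ coordVal N i τ) p / MvPolynomial.eval (fun i ↦ coordVal N i τ) q)) < 1 := by
  set cp := MvPolynomial.eval (fun i ↦ coordVal N i τ) p
  set cq := MvPolynomial.eval (fun i ↦ coordVal N i τ) q
  set Q := MvPolynomial.aeval (coordFn N) q
  set Pv := MvPolynomial.aeval (coordFn N) p
  have hqK : q ∉ evalKer N τ := fun hmem ↦ hq ((mem_evalKer_iff τ q).mp hmem)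
  have hQ1 : pointValuation (N := N) τ Q = 1 := pointValuation_aeval_eq_one_of_not_mem hqK
  have hid : (x - algebraMap ℂ (modularFunctionField N) (cp / cq)) * Q =
      (Pv - algebraMap ℂ _ cp) - algebraMap ℂ _ (cp / cq) * (Q - algebraMap ℂ _ cq) := by
    rw [sub_mul, hpq, map_div₀]
    field_simp [(_root_.map_ne_zero (algebraMap ℂ (modularFunctionField N))).mpr hq]
    ring
  have hlt : pointValuation (N := N) τ ((x - algebraMap ℂ (modularFunctionField N) (cp / cq)) * Q) < 1 := by
    rw [hid]
    refine (Valuation.map_sub _ _ _).trans_lt (max_lt (pointValuation_aeval_sub_eval_lt_one p τ) ?_)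
    rw [Valuation.map_mul]
    calc _ ≤ 1 * pointValuation (N := N) τ (Q - algebraMap ℂ _ cq) :=
          mul_le_mul' (pointValuation_algebraMap_le_one _ τ) le_rfl
      _ < 1 := by rw [one_mul]; exact pointValuation_aeval_sub_eval_lt_one q τ
  rwa [Valuation.map_mul, hQ1, mul_one] at hlt

/-- A representation with `q(v(τ)) ≠ 0` places `x` in `O_{P_τ}`. [folklore] -/
theorem mem_pointPlace_of_mul_aeval_eq (τ : ℍ) {x : modularFunctionField N}
    {p q : CoordPoly} (hq : MvPolynomial.eval (fun i ↦ coordVal N i τ) q ≠ 0)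
    (hpq : x * MvPolynomial.aeval (coordFn N) q = MvPolynomial.aeval (coordFn N) p) :
    x ∈ (pointPlace (N := N) τ).toValuationSubring :=
  mem_pointPlace_of_pointValuation_sub_lt_one (pointValuation_sub_div_lt_one_of_mul_aeval_eq τ hq hpq)

/-- **Transport of a representation**: if `σ` fixes the `q`-series of `x` then `x·q^σ(v) = p^σ(v)`.
[folklore] -/
theorem mul_aeval_map_eq {σ : ℂ →+* ℂ} {x : modularFunctionField N}
    (hx : mapLaurent σ (x : LaurentSeries ℂ) = x) {p q : CoordPoly}
    (hpq : x * MvPolynomial.aeval (coordFn N) q = MvPolynomial.aeval (coordFn N) p) :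
    x * MvPolynomial.aeval (coordFn N) (MvPolynomial.map σ q) = MvPolynomial.aeval (coordFn N) (MvPolynomial.map σ p) := by
  apply Subtype.ext
  change (x : LaurentSeries ℂ) * ((MvPolynomial.aeval (coordFn N) (MvPolynomial.map σ q) : modularFunctionField N) :
      LaurentSeries ℂ) = ((MvPolynomial.aeval (coordFn N) (MvPolynomial.map σ p) : modularFunctionField N) : LaurentSeries ℂ)
  rw [← mapLaurent_aeval σ q, ← mapLaurent_aeval σ p, ← hx, ← map_mul]
  exact congrArg (mapLaurent σ) (congrArg Subtype.val hpq)

omit [NeZero N] in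
/-- Evaluation after `σ`: `q^σ(σ ∘ c) = σ(q(c))`. [folklore] -/
theorem eval_map_eq_of_apply_eq {σ : ℂ →+* ℂ} {c c' : Fin 8 → ℂ} (hc : ∀ i, σ (c i) = c' i) (r : CoordPoly) :
    MvPolynomial.eval c' (MvPolynomial.map σ r) = σ (MvPolynomial.eval c r) := by
  have hc' : c' = σ ∘ c := funext fun i ↦ (hc i).symm
  rw [MvPolynomial.eval_map, hc', show MvPolynomial.eval c r = MvPolynomial.eval₂ (RingHom.id ℂ) c r from rfl,
    MvPolynomial.eval₂_comp_left, RingHom.comp_id]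

end ModularForms

/-! ### The transport theorem for `℘_Λ(c·u)`, `℘_Λ'(c·u)` along `LevelTransport` -/

namespace ModularForms.ModularParametrizationData

variable {W : WeierstrassCurve ℚ}

/-- **Transport of the values of the analytic modular parametrisation along `Aut(ℂ)`.**  Let
`Dt` be a modular parametrisation datum for `W/ℚ` at level `N` (`φ = uniformize(c·u)`,
`u = 2πi∫f`, `Λ = Λ_E ⊇ cΛ_f`), `σ ∈ Aut(ℂ)`, and `τ, τ' ∈ ℍ` with `LevelTransport N σ τ τ'`
(the invariants of `(Λ_τ, Λ_{Nτ})` are carried by `σ` to those of `(Λ_{τ'}, Λ_{Nτ'})` up to a common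
homothety).  Then `c·u(τ) ∈ Λ ↔ c·u(τ') ∈ Λ`, and off the lattice
`σ(℘_Λ(c·u(τ))) = ℘_Λ(c·u(τ'))`, `σ(℘_Λ'(c·u(τ))) = ℘_Λ'(c·u(τ'))`.
[cite: ShimuraIATAF1971, Thm. 7.14] -/
theorem transport_weierstrassP_values (Dt : ModularParametrizationData W N) (σ : ℂ ≃+* ℂ) {τ τ' : ℍ}
    (hT : LevelTransport N σ τ τ') :
    ((Dt.c : ℂ) * eichlerIntegral Dt.f τ ∈ Dt.L.lattice ↔ (Dt.c : ℂ) * eichlerIntegral Dt.f τ' ∈ Dt.L.lattice) ∧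
    ((Dt.c : ℂ) * eichlerIntegral Dt.f τ ∉ Dt.L.lattice →
      σ (℘[Dt.L] ((Dt.c : ℂ) * eichlerIntegral Dt.f τ)) = ℘[Dt.L] ((Dt.c : ℂ) * eichlerIntegral Dt.f τ') ∧
      σ (℘'[Dt.L] ((Dt.c : ℂ) * eichlerIntegral Dt.f τ)) = ℘'[Dt.L] ((Dt.c : ℂ) * eichlerIntegral Dt.f τ')) := by
  classical
  -- the datum
  have hc : (Dt.c : ℂ) ≠ 0 := by exact_mod_cast maninConstant_ne_zero_holds Dt
  have hf : Dt.f ≠ 0 := Dt.isNewformOf.1.ne_zero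
  have hrat : ∀ n, ∃ q : ℚ, (q : ℂ) = cuspCoeff Dt.f n := fun n ↦
    ⟨W.LFunction n, by rw [Dt.isNewformOf.2 n]; norm_cast⟩
  have hσq : ∀ q : ℚ, σ (algebraMap ℚ ℂ q) = algebraMap ℚ ℂ q := fun q ↦ by rw [eq_ratCast, map_ratCast]
  have hσc : σ (Dt.c : ℂ) = Dt.c := map_intCast σ Dt.c
  -- the rescaled lattice `c⁻¹Λ`
  set L' := Dt.L.mulLeft (Dt.c : ℂ)⁻¹ (inv_ne_zero hc) with hL'
  have hmemL' : ∀ z, z ∈ L'.lattice ↔ (Dt.c : ℂ) * z ∈ Dt.L.lattice := fun z ↦ by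
    rw [hL', PeriodPair.mem_mulLeft_lattice, inv_inv]
  have hΛ : ∀ x ∈ periodLattice Dt.f, x ∈ L'.lattice := fun x hx ↦ (hmemL' x).mpr (Dt.smul_periodLattice_le x hx)
  have h℘ : ∀ z, ℘[Dt.L] ((Dt.c : ℂ) * z) = ((Dt.c : ℂ) ^ 2)⁻¹ * ℘[L'] z := fun z ↦ by
    have := PeriodPair.weierstrassP_mulLeft (Dt.c : ℂ)⁻¹ (inv_ne_zero hc) Dt.L ((Dt.c : ℂ) * z)
    rw [← mul_assoc, inv_mul_cancel₀ hc, one_mul, inv_pow, inv_inv] at this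
    rw [← hL'] at this
    rw [this, ← mul_assoc, inv_mul_cancel₀ (pow_ne_zero 2 hc), one_mul]
  have h℘' : ∀ z, ℘'[Dt.L] ((Dt.c : ℂ) * z) = ((Dt.c : ℂ) ^ 3)⁻¹ * ℘'[L'] z := fun z ↦ by
    have := PeriodPair.derivWeierstrassP_mulLeft (Dt.c : ℂ)⁻¹ (inv_ne_zero hc) Dt.L ((Dt.c : ℂ) * z)
    rw [← mul_assoc, inv_mul_cancel₀ hc, one_mul, inv_pow, inv_inv] at this
    rw [← hL'] at this
    rw [this, ← mul_assoc, inv_mul_cancel₀ (pow_ne_zero 3 hc), one_mul]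
  -- `σ` fixes the (rational) invariants of `c⁻¹Λ`
  have hg₂ : σ L'.g₂ = L'.g₂ := by
    rw [hL', PeriodPair.g₂_mulLeft, Dt.isNeronLattice.1]
    simp only [WeierstrassCurve.baseChange, WeierstrassCurve.map_c₄, map_mul, map_inv₀, map_pow, map_div₀,
      map_ofNat, hσq, hσc]
  have hg₃ : σ L'.g₃ = L'.g₃ := by
    rw [hL', PeriodPair.g₃_mulLeft, Dt.isNeronLattice.2]
    simp only [WeierstrassCurve.baseChange, WeierstrassCurve.map_c₆, map_mul, map_inv₀, map_pow, map_div₀,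
      map_ofNat, hσq, hσc]
  -- a presentation of `x`, the coordinate transport, evaluation after `σ`
  obtain ⟨k, F, G, -, h⟩ := exists_isXPresentation Dt.f hf L' hΛ
  have hRx := h.mapLaurent_xFn hf hrat σ hg₂ hg₃
  have hRy := h.mapLaurent_yFn hf hrat σ hg₂ hg₃
  have heval : ∀ r : CoordPoly, MvPolynomial.eval (fun i ↦ coordVal N i τ') (MvPolynomial.map (σ : ℂ →+* ℂ) r) =
      σ (MvPolynomial.eval (fun i ↦ coordVal N i τ) r) := fun r ↦
    eval_map_eq_of_apply_eq (fun i ↦ hT.apply_coordVal i) r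
  have hσne : ∀ {z : ℂ}, z ≠ 0 → σ z ≠ 0 := fun hz ↦ (_root_.map_ne_zero σ).mpr hz
  by_cases hτ : eichlerIntegral Dt.f τ ∈ L'.lattice
  · -- a pole: `x⁻¹` vanishes at `τ`, hence at `τ'`
    have hinv_lt := h.pointValuation_xFn_inv_lt_one hf hτ
    have hinv_mem : (h.xFn)⁻¹ ∈ (pointPlace (N := N) τ).toValuationSubring :=
      (mem_pointPlace_iff τ _).mpr hinv_lt.le
    obtain ⟨p, q, hq, hpq, hval⟩ := exists_pointValuation_sub_div_lt_one τ hinv_mem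
    have h0val : pointValuation (N := N) τ ((h.xFn)⁻¹ - algebraMap ℂ (modularFunctionField N) 0) < 1 := by
      rwa [map_zero, sub_zero]
    have hp0 : MvPolynomial.eval (fun i ↦ coordVal N i τ) p = 0 := by
      have h0 := eq_of_pointValuation_sub_lt_one hval h0val
      rcases div_eq_zero_iff.mp h0 with h1 | h1
      · exact h1
      · exact absurd h1 hq
    have hx' : mapLaurent (σ : ℂ →+* ℂ) (((h.xFn)⁻¹ : modularFunctionField N) : LaurentSeries ℂ) = (h.xFn)⁻¹ := by
      have hci : (((h.xFn)⁻¹ : modularFunctionField N) : LaurentSeries ℂ) =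
          ((h.xFn : modularFunctionField N) : LaurentSeries ℂ)⁻¹ := rfl
      rw [hci, map_inv₀, hRx]
    have hpqσ := mul_aeval_map_eq hx' hpq
    have hqσ : MvPolynomial.eval (fun i ↦ coordVal N i τ') (MvPolynomial.map (σ : ℂ →+* ℂ) q) ≠ 0 := by
      rw [heval]; exact hσne hq
    have hvalσ := pointValuation_sub_div_lt_one_of_mul_aeval_eq τ' hqσ hpqσ
    rw [heval p, hp0, map_zero, zero_div, map_zero, sub_zero] at hvalσ
    have hnot : h.xFn ∉ (pointPlace (N := N) τ').toValuationSubring := fun hmem ↦ by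
      have h1 : pointValuation (N := N) τ' h.xFn ≤ 1 := (mem_pointPlace_iff _ _).mp hmem
      have h2 : pointValuation (N := N) τ' (h.xFn * (h.xFn)⁻¹) < 1 := by
        rw [Valuation.map_mul]
        calc _ ≤ 1 * pointValuation (N := N) τ' (h.xFn)⁻¹ := mul_le_mul' h1 le_rfl
          _ < 1 := by rw [one_mul]; exact hvalσ
      rw [mul_inv_cancel₀ (h.xFn_ne_zero hf), Valuation.map_one] at h2
      exact lt_irrefl _ h2
    have hτ' : eichlerIntegral Dt.f τ' ∈ L'.lattice := by
      by_contra h'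
      exact hnot (h.xFn_mem_pointPlace τ' h')
    exact ⟨⟨fun _ ↦ (hmemL' _).mp hτ', fun _ ↦ (hmemL' _).mp hτ⟩, fun hnm ↦ absurd ((hmemL' _).mp hτ) hnm⟩
  · -- a regular point: values of `x` and `y` transport
    -- `x`
    have hxmem := h.xFn_mem_pointPlace τ hτ
    obtain ⟨p, q, hq, hpq, hval⟩ := exists_pointValuation_sub_div_lt_one τ hxmem
    have hx₀ := eq_of_pointValuation_sub_lt_one (h.pointValuation_xFn_sub_lt_one τ hτ) hval
    have hpqσ := mul_aeval_map_eq hRx hpq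
    have hqσ : MvPolynomial.eval (fun i ↦ coordVal N i τ') (MvPolynomial.map (σ : ℂ →+* ℂ) q) ≠ 0 := by
      rw [heval]; exact hσne hq
    have hxmem' : h.xFn ∈ (pointPlace (N := N) τ').toValuationSubring := mem_pointPlace_of_mul_aeval_eq τ' hqσ hpqσ
    have hτ' : eichlerIntegral Dt.f τ' ∉ L'.lattice := (h.xFn_mem_pointPlace_iff hf τ').mp hxmem'
    have hx₁ := eq_of_pointValuation_sub_lt_one (h.pointValuation_xFn_sub_lt_one τ' hτ')
      (pointValuation_sub_div_lt_one_of_mul_aeval_eq τ' hqσ hpqσ)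
    rw [heval, heval, ← map_div₀, ← hx₀] at hx₁
    -- `y`
    have hymem := h.yFn_mem_pointPlace hf τ hτ
    obtain ⟨p₂, q₂, hq₂, hpq₂, hval₂⟩ := exists_pointValuation_sub_div_lt_one τ hymem
    have hy₀ := eq_of_pointValuation_sub_lt_one (h.pointValuation_yFn_sub_lt_one hf τ hτ) hval₂
    have hpqσ₂ := mul_aeval_map_eq hRy hpq₂
    have hqσ₂ : MvPolynomial.eval (fun i ↦ coordVal N i τ') (MvPolynomial.map (σ : ℂ →+* ℂ) q₂) ≠ 0 := by
      rw [heval]; exact hσne hq₂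
    have hy₁ := eq_of_pointValuation_sub_lt_one (h.pointValuation_yFn_sub_lt_one hf τ' hτ')
      (pointValuation_sub_div_lt_one_of_mul_aeval_eq τ' hqσ₂ hpqσ₂)
    rw [heval, heval, ← map_div₀, ← hy₀] at hy₁
    -- back to `Λ` and `c·u`
    have hτΛ : (Dt.c : ℂ) * eichlerIntegral Dt.f τ ∉ Dt.L.lattice := fun h' ↦ hτ ((hmemL' _).mpr h')
    have hτ'Λ : (Dt.c : ℂ) * eichlerIntegral Dt.f τ' ∉ Dt.L.lattice := fun h' ↦ hτ' ((hmemL' _).mpr h')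
    refine ⟨iff_of_false hτΛ hτ'Λ, fun _ ↦ ⟨?_, ?_⟩⟩
    · rw [h℘, h℘, map_mul, map_inv₀, map_pow, hσc, ← hx₁]
    · rw [h℘', h℘', map_mul, map_inv₀, map_pow, hσc, ← hy₁]

/-- **The modular parametrisation is `Aut(ℂ)`-equivariant at level-`N` Heegner points**, for every
datum and every discriminant. [cite: Darmon2004, Thm. 3.6, proof (PDF p. 43)] -/
theorem isAutEquivariantOnHeegner (Dt : ModularParametrizationData W N) (D : ℤ) :
    Dt.IsAutEquivariantOnHeegner D :=
  Dt.isAutEquivariantOnHeegner_of_weierstrassP fun σ _ _ _ _ _ hT ↦ Dt.transport_weierstrassP_values σ hT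

end ModularForms.ModularParametrizationData

/-! ### The discharge -/

section Discharge

variable (N : ℕ) [NeZero N] (W : WeierstrassCurve ℚ) (K : Type u) [Field K] [NumberField K]

/-- **Discharge of `heegnerPointComplex_mem_range_map`** (Darmon 2004, Thm. 3.6: the complex Heegner
point `φ(τ)`, `τ ∈ HP_N(d_K)`, lies in `E(K̄)` — indeed in the image of `E(K)` under the complex
embedding, `K` being identified with the compositum as in the fact).
[cite: Darmon2004, Thm. 3.6 (PDF p. 43)] -/
theorem heegnerPointComplex_mem_range_map_holds : heegnerPointComplex_mem_range_map N W K :=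
  heegnerPointComplex_mem_range_map_of_isAutEquivariantOnHeegner fun Dt ↦
    ModularForms.ModularParametrizationData.isAutEquivariantOnHeegner Dt _

/-- **Discharge of `heegnerPoints_galoisConj`** (Darmon 2004, Thms. 3.6–3.7: the Heegner points
`φ(τ_Q)`, `Q ∈ H.reps`, come from a `Gal(H_K/K)`-permuted family of points over the field of singular
moduli): `heegnerPoints_galoisConj_of_isAutEquivariantOnHeegner` (`HeegnerPointsShimuraReduction.lean`)
fed with the `Aut(ℂ)`-equivariance of every datum proved above (`isAutEquivariantOnHeegner`).
[cite: Darmon2004, Thm. 3.6 and Thm. 3.7 (PDF pp. 43–44)] -/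
theorem heegnerPoints_galoisConj_holds : heegnerPoints_galoisConj N W K :=
  heegnerPoints_galoisConj_of_isAutEquivariantOnHeegner fun Dt ↦
    ModularForms.ModularParametrizationData.isAutEquivariantOnHeegner Dt _

end Discharge

end Literature.NumberTheory.EllipticCurves

end
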